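import Summits.PneNP.PneNP.Theorems.ChebyshevTracialDesignCrossingPlaneTools
import HarnessLib

/-!
# Cell pnp-psdrank, route `ChebyshevTracialDesign`: THE CROSSING-PLANE REDUCTION — per matching, the tilted (CG_1′) value of a block
# statistic in a crossing-plane direction is minus the virtual value of an UNTILTED block statistic, up to pure remainders
# (crux `TracialDecayExp20`, stmt-PneNP-19878)

Brick 120 (prover g22; MEMO-25 §2(c), §4 (O2)). The (CG_1′) containment form of a mask `f(U) = ψ(|U∩H|)` at a matching `M` in direction
`u` is `Σ_U W(U,M)·ψ(|U∩H|)·C_u(U)²`, `C_u(U) = Σ_p u_p x_p x_{π_M p}` (bricks 101–106). For `u` in the CROSSING PLANE of the block `H`,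
`u_p = λ·([p∈H][πp∈H] − [p∉H][πp∉H]) + (λ+κ)` (spanned by the crossing direction `𝟙_{HH} − 𝟙_{H̄H̄}` and the level direction `𝟙`),
Literature `crossingWeight_containment_eq` gives ON EVERY CUT `C_u = 2λ(X − Y) + κ(|U| − cc(U,M))`, `X = |U∩H|`, `Y = |half_M U ∩ H|`, so
`ψ(X)·C_u² = ψ₀(X) − 2κ·cc·ψ₁(X) + κ²·cc²·ψ(X) − 4λ·Y·ψ₁(X) + 4λκ·cc·Y·ψ(X) + 4λ²·Y·ψ(X) + 4λ²·Y(Y−1)·ψ(X)`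
with `ψ₁(x) = ψ(x)(2λx + κt)`, `ψ₀(x) = ψ(x)(2λx + κt)²` (brick 120a `pointwise_expansion`). Term by term: `ψ₀` is a plain block statistic (brick 117:
design value `= −N^{odd}_D φ₀(0) ±` remainder); the `cc`- and `cc²`-weighted plain terms vanish at the virtual level (brick 119 §1 and
brick 120a `abs_levelSum_levelSqMul_le`); the `Y`-terms are bricks 119 / 119b. Hence

* **`abs_crossingPlane_value_add_newton_le`** (THE THEOREM): for every exact design, matching `M`, block `H`, `|ψ| ≤ G` on `[0,t]`,
  `|λ|, |κ| ≤ 1`: `| |PM|·Σ_U W(U,M)·ψ(|U∩H|)·(Σ_p u_p x_p x_{πp})² + N^{odd}_D[φ₀](0) | ≤ R₀ + 2R₁ + R₂ + 4R₃ + 4R₄ + 4R₅ + 4R₆`,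
  `φ₀(c) = E_{Shell_c(M)}[ψ₀(|U∩H|)]`, the `R_i` the explicit pure remainders of bricks 117/119/119b (orders `D−1 … D+1` of the `x`-smoothness
  numbers `X_k` of deleted shell laws, one uniform hypothesis family `hX` over ground sets `[n]` minus `≤ 2` pinned and `2k` deleted edges, levels `c′ + 2k ≤ T`).
READING (MEMO-25 §2(c)): IN THE CROSSING PLANE, (CG_1′) FOR BLOCK STATISTICS IS — PER MATCHING AND UP TO SUPER-POLYNOMIALLY SMALL
REMAINDERS — THE SIGN OF THE VIRTUAL VALUE `N^{odd}_D φ₀(0)` OF THE NONNEGATIVE UNTILTED BLOCK STATISTIC `ψ(x)(2λx+κt)²`; numerically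
(MEMO-25 §1) that virtual value is the Gamma-continued level-0 hypergeometric expectation `Σ_x ψ(x)(2λx+κt)² P̃_{t/2}(x) ≥ 0` up to
`n^{−Θ(D)} + 2^{−Ω(b)}` — the open point (O1). WHAT THIS FILE DOES NOT DO: sign `N^{odd}_D φ₀(0)` (that is (O1)); directions outside the
crossing plane (two-block chain, (O3)); bound the `X_k` (bricks 118); anything on `TracialDecayExp20` itself, psd rank, or P vs NP.
[cite: Rothvoss2017, §2 (PDF p. 6)] [cite: Agarwal2000DifferenceEquations, Thm. 1.8.5 (1.8.6), Remark 1.8.1 (1.8.8)]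
[cite: GriblingDelaatLaurent2019, §5]
Stature: support/instrument (kernel lane, no defs, axioms standard). Supports stmt-PneNP-19878.
-/

set_option linter.dupNamespace false -- `Summit.PneNP.PneNP.…`: summit = sub-problem (D-0017)

noncomputable section

namespace Summit.PneNP.PneNP.Theorems.ChebyshevTracialDesignCrossingPlaneReduction

open Finset Polynomial Literature.Barriers.PneNP Literature.Combinatorics.Optimization
open Literature.Combinatorics.Optimization.ShellStep
open Summit.PneNP.PneNP.Theorems.ChebyshevTracialDesignShellOperatorForm (designValue_eq_shellAvg shell_partner_nonempty)
open Summit.PneNP.PneNP.Theorems.ChebyshevTracialDesignBlockStatisticPricing (fwdDiff_iter_one_odd pairs_hyp rho_nonneg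
  abs_fwdDiff_iter_shellProfile_le abs_designValue_blockStat_add_newton_le)
open Summit.PneNP.PneNP.Theorems.ChebyshevTracialDesignHalfPinnedNull (fwdDiff_iter_levelMul fwdDiff_iter_mul_sum
  abs_levelSum_levelMul_le fwdDiff_iter_one_even abs_fwdDiff_iter_deletedProfile_le abs_designValue_halfCount_blockStat_le)
open Summit.PneNP.PneNP.Theorems.ChebyshevTracialDesignHalfPairsNull (abs_designValue_halfPairs_blockStat_le)
open Summit.PneNP.PneNP.Theorems.ChebyshevTracialDesignCrossingPlaneTools (abs_levelSum_levelSqMul_le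
  levelWeight_eq_zero_of_card_ne designValue_ccPow_eq_shellAvg abs_seven_le)

variable {n : ℕ}

/-! ### The crossing-plane reduction -/

/-- **THE CROSSING-PLANE REDUCTION (brick 120).** For an exact design `(n,t,T,D,B_v,C,w)` with `t = t₁ + 2(D+1) + 2`, a perfect
matching `M` (partner map `π`), a block `H`, a profile `|ψ| ≤ G` on `[0,t]`, crossing-plane parameters `|λ|, |κ| ≤ 1`
(`u_p = λ([p∈H][πp∈H] − [p∉H][πp∉H]) + (λ+κ)`), `m ≥ 3`, `m + 4(D+1) + 4 ≤ n`, `2D+1 ≤ T`, and ONE family of `x`-smoothness numbers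
`X_k ≥ 0` (`k ≤ D+1`; every level `c′` with `c′ + 2k ≤ T`; every `π`-stable `S′` with `|S′| + 4k + 2e = n`, `e ≤ 2`; cut `t − e − 2k`, window `[0, t−e]`):
`| |PM|·Σ_U W(U,M)·ψ(|U∩H|)·(Σ_p u_p x_p x_{πp})² + N^{odd}_D[φ₀](0) | ≤ R₀ + 2R₁ + R₂ + 4R₃ + 4R₄ + 4R₅ + 4R₆`
where `φ₀(c) = E_{Shell_c(M)}[ψ(X)(2λX+κt)²]` and, with `ρ = m/(4(m−2))`, `c_D = (2D+1)C(2D,D)/4^D`, `b = B_v·C((T−1)/2,D+1)`,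
`K_k(G′,q) := q·G′·ρ^k X_k`: `R₀ = b·9t²G·ρ^{D+1}X_{D+1}` (brick 117), `R₁ = c_D K_D(3tG,1) + b(T K_{D+1}(3tG,1) + 2(D+1)K_D(3tG,1))` (brick 119 §1),
`R₂` = §1 here with `K_k(G,1)`, `R₃` = brick 119 with `K_k(3tG, |H|/n)`, `R₄` = §1 here with `K_k(G, |H|/n)`, `R₅` = brick 119 with
`K_k(G,|H|/n)`, `R₆` = brick 119b. All seven are pure remainders of orders `D−1, D, D+1`.
[cite: Rothvoss2017, §2 (PDF p. 6)] [cite: Agarwal2000DifferenceEquations, Thm. 1.8.5 (1.8.6), Remark 1.8.1 (1.8.8)]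
[cite: GriblingDelaatLaurent2019, §5] -/
theorem abs_crossingPlane_value_add_newton_le {t₁ T D : ℕ} {Bv : ℝ} {C : Finset ℕ} {w : ℕ → ℝ}
    (hdes : IsExactDesign n (t₁ + 2 * (D + 1) + 2) T D Bv C w) (hDT : 2 * D + 1 ≤ T) (M : PMatch n)
    (H : Finset (Fin n)) (ψ : ℤ → ℝ) {G : ℝ} (hG0 : 0 ≤ G)
    (hG : ∀ x ∈ Icc (0 : ℤ) ((t₁ + 2 * (D + 1) + 2 : ℕ) : ℤ), |ψ x| ≤ G)
    (lam kap : ℝ) (hlam : |lam| ≤ 1) (hkap : |kap| ≤ 1)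
    {m : ℕ} (hm : 3 ≤ m) (hmn : m + 4 * (D + 1) + 4 ≤ n) (X : ℕ → ℝ) (hX0 : ∀ k, 0 ≤ X k)
    (hX : ∀ k, k ≤ D + 1 → ∀ e, e ≤ 2 → ∀ c' : ℕ, c' + 2 * k ≤ T → ∀ S' : Finset (Fin n), (∀ u ∈ S', M.2.partner u ∈ S') →
      S'.card + 4 * k + 2 * e = n →
      ∑ x ∈ Icc (0 : ℤ) ((t₁ + 2 * (D + 1) + 2 - e : ℕ) : ℤ),
        |nab2^[k] (fun c x => shellLaw M.2.partner S' H (t₁ + 2 * (D + 1) + 2 - e - 2 * k) c x : Profile) c' x| ≤ X k) :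
    |(Fintype.card (PMatch n) : ℝ) * ∑ U : OddSet n, levelWeight n (t₁ + 2 * (D + 1) + 2) C w U M *
        (ψ ((U.1 ∩ H).card : ℤ) *
          (∑ p : Fin n, (lam * ((if (p ∈ H ∧ M.2.partner p ∈ H) then (1 : ℝ) else 0) -
              (if (p ∉ H ∧ M.2.partner p ∉ H) then (1 : ℝ) else 0)) + (lam + kap)) *
            ((if p ∈ U.1 then (1 : ℝ) else 0) * (if M.2.partner p ∈ U.1 then (1 : ℝ) else 0))) ^ 2) +
      (DesignRemainder.newtonPolyOdd D (fun c =>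
        (∑ U' ∈ shell M.2.partner (t₁ + 2 * (D + 1) + 2) c,
          ψ ((U' ∩ H).card : ℤ) * (2 * lam * ((U' ∩ H).card : ℤ) + kap * ((t₁ + 2 * (D + 1) + 2 : ℕ) : ℝ)) ^ 2) /
          ((shell M.2.partner (t₁ + 2 * (D + 1) + 2) c).card : ℝ))).eval 0| ≤
      -- R₀
      Bv * ((((T - 1) / 2).choose (D + 1) : ℕ) : ℝ) *
          ((9 * ((t₁ + 2 * (D + 1) + 2 : ℕ) : ℝ) ^ 2 * G) * (((m : ℝ) / (4 * ((m : ℝ) - 2))) ^ (D + 1) * X (D + 1))) +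
      -- 2 R₁
      2 * ((2 * (D : ℝ) + 1) * ((((2 * D).choose D : ℕ) : ℝ) / (4 : ℝ) ^ D) *
            ((3 * ((t₁ + 2 * (D + 1) + 2 : ℕ) : ℝ) * G) * (((m : ℝ) / (4 * ((m : ℝ) - 2))) ^ D * X D)) +
          Bv * ((((T - 1) / 2).choose (D + 1) : ℕ) : ℝ) *
            ((T : ℝ) * ((3 * ((t₁ + 2 * (D + 1) + 2 : ℕ) : ℝ) * G) * (((m : ℝ) / (4 * ((m : ℝ) - 2))) ^ (D + 1) * X (D + 1))) +
              2 * ((D : ℝ) + 1) * ((3 * ((t₁ + 2 * (D + 1) + 2 : ℕ) : ℝ) * G) * (((m : ℝ) / (4 * ((m : ℝ) - 2))) ^ D * X D)))) +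
      -- R₂
      ((2 * (D : ℝ) + 1) * ((((2 * D).choose D : ℕ) : ℝ) / (4 : ℝ) ^ D) *
          ((T : ℝ) * (G * (((m : ℝ) / (4 * ((m : ℝ) - 2))) ^ D * X D)) +
            2 * (D : ℝ) * (G * (((m : ℝ) / (4 * ((m : ℝ) - 2))) ^ (D - 1) * X (D - 1)))) +
        Bv * ((((T - 1) / 2).choose (D + 1) : ℕ) : ℝ) *
          ((T : ℝ) * ((T : ℝ) * (G * (((m : ℝ) / (4 * ((m : ℝ) - 2))) ^ (D + 1) * X (D + 1))) +
              2 * ((D : ℝ) + 1) * (G * (((m : ℝ) / (4 * ((m : ℝ) - 2))) ^ D * X D))) +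
            2 * ((D : ℝ) + 1) * ((T : ℝ) * (G * (((m : ℝ) / (4 * ((m : ℝ) - 2))) ^ D * X D)) +
              2 * (D : ℝ) * (G * (((m : ℝ) / (4 * ((m : ℝ) - 2))) ^ (D - 1) * X (D - 1)))))) +
      -- 4 R₃
      4 * ((2 * (D : ℝ) + 1) * ((((2 * D).choose D : ℕ) : ℝ) / (4 : ℝ) ^ D) *
            (((H.card : ℝ) / n) * ((3 * ((t₁ + 2 * (D + 1) + 2 : ℕ) : ℝ) * G) * (((m : ℝ) / (4 * ((m : ℝ) - 2))) ^ D * X D))) +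
          Bv * ((((T - 1) / 2).choose (D + 1) : ℕ) : ℝ) *
            ((T : ℝ) * (((H.card : ℝ) / n) * ((3 * ((t₁ + 2 * (D + 1) + 2 : ℕ) : ℝ) * G) *
                (((m : ℝ) / (4 * ((m : ℝ) - 2))) ^ (D + 1) * X (D + 1)))) +
              2 * ((D : ℝ) + 1) * (((H.card : ℝ) / n) * ((3 * ((t₁ + 2 * (D + 1) + 2 : ℕ) : ℝ) * G) *
                (((m : ℝ) / (4 * ((m : ℝ) - 2))) ^ D * X D))))) +
      -- 4 R₄
      4 * ((2 * (D : ℝ) + 1) * ((((2 * D).choose D : ℕ) : ℝ) / (4 : ℝ) ^ D) *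
            ((T : ℝ) * (((H.card : ℝ) / n) * (G * (((m : ℝ) / (4 * ((m : ℝ) - 2))) ^ D * X D))) +
              2 * (D : ℝ) * (((H.card : ℝ) / n) * (G * (((m : ℝ) / (4 * ((m : ℝ) - 2))) ^ (D - 1) * X (D - 1))))) +
          Bv * ((((T - 1) / 2).choose (D + 1) : ℕ) : ℝ) *
            ((T : ℝ) * ((T : ℝ) * (((H.card : ℝ) / n) * (G * (((m : ℝ) / (4 * ((m : ℝ) - 2))) ^ (D + 1) * X (D + 1)))) +
                2 * ((D : ℝ) + 1) * (((H.card : ℝ) / n) * (G * (((m : ℝ) / (4 * ((m : ℝ) - 2))) ^ D * X D)))) +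
              2 * ((D : ℝ) + 1) * ((T : ℝ) * (((H.card : ℝ) / n) * (G * (((m : ℝ) / (4 * ((m : ℝ) - 2))) ^ D * X D))) +
                2 * (D : ℝ) * (((H.card : ℝ) / n) * (G * (((m : ℝ) / (4 * ((m : ℝ) - 2))) ^ (D - 1) * X (D - 1))))))) +
      -- 4 R₅
      4 * ((2 * (D : ℝ) + 1) * ((((2 * D).choose D : ℕ) : ℝ) / (4 : ℝ) ^ D) *
            (((H.card : ℝ) / n) * (G * (((m : ℝ) / (4 * ((m : ℝ) - 2))) ^ D * X D))) +
          Bv * ((((T - 1) / 2).choose (D + 1) : ℕ) : ℝ) *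
            ((T : ℝ) * (((H.card : ℝ) / n) * (G * (((m : ℝ) / (4 * ((m : ℝ) - 2))) ^ (D + 1) * X (D + 1)))) +
              2 * ((D : ℝ) + 1) * (((H.card : ℝ) / n) * (G * (((m : ℝ) / (4 * ((m : ℝ) - 2))) ^ D * X D))))) +
      -- 4 R₆
      4 * ((2 * (D : ℝ) + 1) * ((((2 * D).choose D : ℕ) : ℝ) / (4 : ℝ) ^ D) *
            (((H.card : ℝ) ^ 2 / ((n : ℝ) * ((n : ℝ) - 2))) * (G * ((T : ℝ) * (((m : ℝ) / (4 * ((m : ℝ) - 2))) ^ D * X D) +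
              2 * (D : ℝ) * (((m : ℝ) / (4 * ((m : ℝ) - 2))) ^ (D - 1) * X (D - 1))))) +
          Bv * ((((T - 1) / 2).choose (D + 1) : ℕ) : ℝ) *
            ((T : ℝ) * (((H.card : ℝ) ^ 2 / ((n : ℝ) * ((n : ℝ) - 2))) *
                (G * ((T : ℝ) * (((m : ℝ) / (4 * ((m : ℝ) - 2))) ^ (D + 1) * X (D + 1)) +
                  2 * ((D : ℝ) + 1) * (((m : ℝ) / (4 * ((m : ℝ) - 2))) ^ D * X D)))) +
              2 * ((D : ℝ) + 1) * (((H.card : ℝ) ^ 2 / ((n : ℝ) * ((n : ℝ) - 2))) *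
                (G * ((T : ℝ) * (((m : ℝ) / (4 * ((m : ℝ) - 2))) ^ D * X D) +
                  2 * (D : ℝ) * (((m : ℝ) / (4 * ((m : ℝ) - 2))) ^ (D - 1) * X (D - 1))))))) := by
  set t := t₁ + 2 * (D + 1) + 2 with htdef
  set π := M.2.partner with hπdef
  set ρ : ℝ := (m : ℝ) / (4 * ((m : ℝ) - 2)) with hρdef
  set PM : ℝ := (Fintype.card (PMatch n) : ℝ) with hPMdef
  have hπ : ∀ v, π (π v) = v := partner_partner M
  have ht : Odd t := hdes.1
  have h2t : 2 * t + 2 ≤ n := hdes.2.1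
  have hTt : T ≤ t := hdes.2.2.1
  have hPM : (0 : ℝ) < PM := by
    have : 0 < Fintype.card (PMatch n) := Fintype.card_pos_iff.2 ⟨M⟩
    rw [hPMdef]; exact_mod_cast this
  have hρ0 : 0 ≤ ρ := rho_nonneg hm
  have htR : (0 : ℝ) ≤ (t : ℝ) := Nat.cast_nonneg _
  -- the modified profiles
  set ψ₀ : ℤ → ℝ := fun x => ψ x * (2 * lam * (x : ℝ) + kap * (t : ℝ)) ^ 2 with hψ₀
  set ψ₁ : ℤ → ℝ := fun x => ψ x * (2 * lam * (x : ℝ) + kap * (t : ℝ)) with hψ₁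
  have hlin : ∀ x ∈ Icc (0 : ℤ) ((t : ℕ) : ℤ), |2 * lam * (x : ℝ) + kap * (t : ℝ)| ≤ 3 * (t : ℝ) := by
    intro x hx
    rw [mem_Icc] at hx
    have hx0 : (0 : ℝ) ≤ x := by exact_mod_cast hx.1
    have hxt : (x : ℝ) ≤ t := by exact_mod_cast hx.2
    have hl := abs_le.1 hlam
    have hk := abs_le.1 hkap
    rw [abs_le]; constructor <;> nlinarith
  have hG₁ : ∀ x ∈ Icc (0 : ℤ) ((t : ℕ) : ℤ), |ψ₁ x| ≤ 3 * (t : ℝ) * G := by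
    intro x hx
    rw [hψ₁]; simp only
    rw [abs_mul]
    calc |ψ x| * |2 * lam * (x : ℝ) + kap * (t : ℝ)| ≤ G * (3 * (t : ℝ)) :=
          mul_le_mul (hG x hx) (hlin x hx) (abs_nonneg _) hG0
      _ = 3 * (t : ℝ) * G := by ring
  have hG₀ : ∀ x ∈ Icc (0 : ℤ) ((t : ℕ) : ℤ), |ψ₀ x| ≤ 9 * (t : ℝ) ^ 2 * G := by
    intro x hx
    rw [hψ₀]; simp only
    rw [abs_mul, abs_pow]
    have h3 := hlin x hx
    calc |ψ x| * |2 * lam * (x : ℝ) + kap * (t : ℝ)| ^ 2 ≤ G * (3 * (t : ℝ)) ^ 2 :=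
          mul_le_mul (hG x hx) (pow_le_pow_left₀ (abs_nonneg _) h3 2) (by positivity) hG0
      _ = 9 * (t : ℝ) ^ 2 * G := by ring
  have hG₁0 : 0 ≤ 3 * (t : ℝ) * G := by positivity
  have hG₀0 : 0 ≤ 9 * (t : ℝ) ^ 2 * G := by positivity
  -- Step 1: pointwise expansion on the support of the weight
  have hpt : ∀ U : OddSet n, levelWeight n t C w U M * (ψ ((U.1 ∩ H).card : ℤ) *
      (∑ p : Fin n, (lam * ((if (p ∈ H ∧ π p ∈ H) then (1 : ℝ) else 0) -
          (if (p ∉ H ∧ π p ∉ H) then (1 : ℝ) else 0)) + (lam + kap)) *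
        ((if p ∈ U.1 then (1 : ℝ) else 0) * (if π p ∈ U.1 then (1 : ℝ) else 0))) ^ 2) =
      levelWeight n t C w U M * ψ₀ ((U.1 ∩ H).card : ℤ) +
      (-2 * kap) * (levelWeight n t C w U M * ((cc U M : ℝ) ^ 1 * ψ₁ ((U.1 ∩ H).card : ℤ))) +
      kap ^ 2 * (levelWeight n t C w U M * ((cc U M : ℝ) ^ 2 * ψ ((U.1 ∩ H).card : ℤ))) +
      (-4 * lam) * (levelWeight n t C w U M * (((half π U.1 ∩ H).card : ℝ) * ψ₁ ((U.1 ∩ H).card : ℤ))) +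
      (4 * lam * kap) * (levelWeight n t C w U M *
        ((cc U M : ℝ) ^ 1 * (((half π U.1 ∩ H).card : ℝ) * ψ ((U.1 ∩ H).card : ℤ)))) +
      (4 * lam ^ 2) * (levelWeight n t C w U M * (((half π U.1 ∩ H).card : ℝ) * ψ ((U.1 ∩ H).card : ℤ))) +
      (4 * lam ^ 2) * (levelWeight n t C w U M *
        (((half π U.1 ∩ H).card : ℝ) * (((half π U.1 ∩ H).card : ℝ) - 1) * ψ ((U.1 ∩ H).card : ℤ))) := by
    intro U
    by_cases hcard : U.1.card = t
    · have hmem : U.1 ∈ shellIn π univ t (half π U.1).card :=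
        mem_shellIn.2 ⟨subset_univ _, hcard, rfl⟩
      rw [crossingWeight_containment_eq hπ H hmem lam (lam + kap), cc_eq_card_half, hψ₀, hψ₁]
      simp only
      push_cast
      ring
    · rw [levelWeight_eq_zero_of_card_ne t C w U M hcard]
      ring
  -- Step 2: sum and split into the seven design values
  rw [sum_congr rfl fun U _ => hpt U]
  simp only [sum_add_distrib, ← mul_sum]
  -- the seven bounds
  -- bookkeeping of the cut sizes
  have e00 : t - 0 = t₁ + 2 + 2 * (D + 1) := by rw [htdef]; omega
  have e10 : t - 1 = t₁ + 1 + 2 * (D + 1) := by rw [htdef]; omega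
  have e20 : t - 2 = t₁ + 2 * (D + 1) := by rw [htdef]; omega
  -- smoothness of plain profiles at odd levels (brick 117 §1), for any profile bounded by `G'`
  have hKplain : ∀ (χ : ℤ → ℝ) (G' : ℝ), 0 ≤ G' → (∀ x ∈ Icc (0 : ℤ) ((t : ℕ) : ℤ), |χ x| ≤ G') →
      ∀ k, k ≤ D + 1 → ∀ j : ℕ, 2 * (j + k) + 1 ≤ T →
      |((fwdDiff (1 : ℕ))^[k] (fun j => (fun c => (∑ U' ∈ shell π t c, χ ((U' ∩ H).card : ℤ)) /
        ((shell π t c).card : ℝ)) (2 * j + 1))) j| ≤ G' * (ρ ^ k * X k) := by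
    intro χ G' hG'0 hG' k hk j hj
    set φχ : ℕ → ℝ := fun c => (∑ U' ∈ shell π t c, χ ((U' ∩ H).card : ℤ)) / ((shell π t c).card : ℝ) with hφχ
    rw [fwdDiff_iter_one_odd, hφχ]
    have hsplit : t = (t - 2 * k) + 2 * k := by omega
    have this0 := hX k hk 0 (by omega) (2 * j + 1) (by omega)
    simp only [Nat.sub_zero] at this0
    rw [hsplit]
    refine abs_fwdDiff_iter_shellProfile_le M H χ hG'0 (by rw [← hsplit]; exact hG') (by rw [← hsplit]; exact ht)
      ⟨j, by ring⟩ (by omega) (by omega) hm (by omega) (hX0 k) ?_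
    intro S' hS' hcard
    have := this0 S' hS' (by omega)
    rw [← hsplit]
    exact this
  -- smoothness of the one-edge-deleted even profiles (brick 119 §2), summed over `v ∈ H`
  set φ' : Fin n → ℕ → ℝ := fun v c => (∑ W ∈ shellIn π (univ \ {v, π v}) (t - 1) c, ψ (((W ∩ H).card : ℤ) + 1)) /
    ((shellIn π (univ \ {v, π v}) (t - 1) c).card : ℝ) with hφ'
  have hG' : ∀ x ∈ Icc (0 : ℤ) ((t - 1 : ℕ) : ℤ), |ψ (x + 1)| ≤ G := by
    intro x hx
    refine hG (x + 1) ?_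
    rw [mem_Icc] at hx ⊢
    obtain ⟨h0, h1⟩ := hx
    have h1' : x ≤ ((t : ℕ) : ℤ) - 1 := by
      have : ((t - 1 : ℕ) : ℤ) = ((t : ℕ) : ℤ) - 1 := by push_cast [Nat.cast_sub (show 1 ≤ t by omega)]; ring
      rw [this] at h1; exact h1
    constructor <;> omega
  have hKhalf : ∀ k, k ≤ D + 1 → ∀ j : ℕ, 2 * (j + k) + 1 ≤ T →
      |((fwdDiff (1 : ℕ))^[k] (fun j => (1 / (n : ℝ)) * ∑ v ∈ H, φ' v (2 * j))) j| ≤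
        ((H.card : ℝ) / n) * (G * (ρ ^ k * X k)) := by
    intro k hk j hj
    have hfun : (fun j => (1 / (n : ℝ)) * ∑ v ∈ H, φ' v (2 * j)) = fun j => (1 / (n : ℝ)) * ∑ v ∈ H, (fun v j => φ' v (2 * j)) v j := rfl
    rw [hfun, fwdDiff_iter_mul_sum, abs_mul, abs_of_nonneg (by positivity : (0 : ℝ) ≤ 1 / (n : ℝ))]
    have hsplit : t - 1 = (t - 1 - 2 * k) + 2 * k := by omega
    have hbd : ∀ v ∈ H, |(fwdDiff (1 : ℕ))^[k] (fun j => φ' v (2 * j)) j| ≤ G * (ρ ^ k * X k) := by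
      intro v _
      rw [fwdDiff_iter_one_even, hφ']
      simp only
      rw [hsplit]
      refine abs_fwdDiff_iter_deletedProfile_le M v H ψ hG0 (by rw [← hsplit]; exact hG')
        (by rw [← hsplit]; obtain ⟨i, hi⟩ := ht; exact ⟨i, by omega⟩) ⟨j, by ring⟩ (by omega) (by omega) hm (by omega) (hX0 k) ?_
      intro S' hS' hcard
      have := hX k hk 1 (by omega) (2 * j) (by omega) S' hS' (by omega)
      rw [← hsplit]
      exact this
    have hsum : |∑ v ∈ H, (fwdDiff (1 : ℕ))^[k] (fun j => φ' v (2 * j)) j| ≤ (H.card : ℝ) * (G * (ρ ^ k * X k)) :=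
      calc |∑ v ∈ H, (fwdDiff (1 : ℕ))^[k] (fun j => φ' v (2 * j)) j|
          ≤ ∑ v ∈ H, |(fwdDiff (1 : ℕ))^[k] (fun j => φ' v (2 * j)) j| := abs_sum_le_sum_abs _ _
        _ ≤ ∑ v ∈ H, G * (ρ ^ k * X k) := sum_le_sum hbd
        _ = (H.card : ℝ) * (G * (ρ ^ k * X k)) := by rw [sum_const, nsmul_eq_mul]
    calc 1 / (n : ℝ) * |∑ v ∈ H, (fwdDiff (1 : ℕ))^[k] (fun j => φ' v (2 * j)) j|
        ≤ 1 / (n : ℝ) * ((H.card : ℝ) * (G * (ρ ^ k * X k))) := mul_le_mul_of_nonneg_left hsum (by positivity)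
      _ = ((H.card : ℝ) / n) * (G * (ρ ^ k * X k)) := by ring
  -- T0: the plain block statistic `ψ₀` (brick 117), multiplied through by `|PM|`
  have hdes0 : IsExactDesign n ((t₁ + 2) + 2 * (D + 1)) T D Bv C w := by
    rw [show t₁ + 2 + 2 * (D + 1) = t by rw [htdef]; ring]; exact hdes
  have hT0 : |PM * ∑ U : OddSet n, levelWeight n t C w U M * ψ₀ ((U.1 ∩ H).card : ℤ) +
      (DesignRemainder.newtonPolyOdd D (fun c =>
        (∑ U' ∈ shell π t c, ψ₀ ((U' ∩ H).card : ℤ)) / ((shell π t c).card : ℝ))).eval 0| ≤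
      Bv * ((((T - 1) / 2).choose (D + 1) : ℕ) : ℝ) * ((9 * (t : ℝ) ^ 2 * G) * (ρ ^ (D + 1) * X (D + 1))) := by
    have htt : t₁ + 2 + 2 * (D + 1) = t := by rw [htdef]; ring
    have h := abs_designValue_blockStat_add_newton_le hdes0 M H ψ₀ hG₀0 (by rw [htt]; exact hG₀) hm (by omega) (hX0 (D + 1))
      (fun c hc hcT S' hS' hcard => by
        have := hX (D + 1) le_rfl 0 (by omega) c (by omega) S' hS' (by omega)
        rw [e00, Nat.add_sub_cancel] at this
        exact this)
    rw [htt] at h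
    have h' := mul_le_mul_of_nonneg_left h hPM.le
    rw [← abs_of_pos hPM, ← abs_mul, abs_of_pos hPM, mul_add, ← mul_assoc, mul_inv_cancel₀ hPM.ne', one_mul,
      ← mul_assoc, mul_inv_cancel₀ hPM.ne', one_mul] at h'
    exact h'
  -- T1: `cc·ψ₁` (brick 119 §1 with the plain smoothness)
  have hT1 : |PM * ∑ U : OddSet n, levelWeight n t C w U M * ((cc U M : ℝ) ^ 1 * ψ₁ ((U.1 ∩ H).card : ℤ))| ≤
      (2 * (D : ℝ) + 1) * ((((2 * D).choose D : ℕ) : ℝ) / (4 : ℝ) ^ D) * ((3 * (t : ℝ) * G) * (ρ ^ D * X D)) +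
        Bv * ((((T - 1) / 2).choose (D + 1) : ℕ) : ℝ) *
          ((T : ℝ) * ((3 * (t : ℝ) * G) * (ρ ^ (D + 1) * X (D + 1))) + 2 * ((D : ℝ) + 1) * ((3 * (t : ℝ) * G) * (ρ ^ D * X D))) := by
    rw [designValue_ccPow_eq_shellAvg t ht C w M (fun U₁ => ψ₁ ((U₁ ∩ H).card : ℤ)) 1, ← mul_assoc,
      mul_inv_cancel₀ hPM.ne', one_mul]
    simp only [pow_one]
    exact abs_levelSum_levelMul_le hdes.exact hdes.variation_le hdes.level_le (fun c hc => (hdes.2.2.2.1 c hc).1) hDT _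
      (mul_nonneg hG₁0 (mul_nonneg (pow_nonneg hρ0 _) (hX0 _))) (mul_nonneg hG₁0 (mul_nonneg (pow_nonneg hρ0 _) (hX0 _)))
      (fun j hj => hKplain ψ₁ _ hG₁0 hG₁ D (by omega) j hj) (fun j hj => hKplain ψ₁ _ hG₁0 hG₁ (D + 1) le_rfl j hj)
  -- T2: `cc²·ψ` (§1 with the plain smoothness)
  have hT2 : |PM * ∑ U : OddSet n, levelWeight n t C w U M * ((cc U M : ℝ) ^ 2 * ψ ((U.1 ∩ H).card : ℤ))| ≤
      (2 * (D : ℝ) + 1) * ((((2 * D).choose D : ℕ) : ℝ) / (4 : ℝ) ^ D) * ((T : ℝ) * (G * (ρ ^ D * X D)) +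
          2 * (D : ℝ) * (G * (ρ ^ (D - 1) * X (D - 1)))) +
        Bv * ((((T - 1) / 2).choose (D + 1) : ℕ) : ℝ) *
          ((T : ℝ) * ((T : ℝ) * (G * (ρ ^ (D + 1) * X (D + 1))) + 2 * ((D : ℝ) + 1) * (G * (ρ ^ D * X D))) +
            2 * ((D : ℝ) + 1) * ((T : ℝ) * (G * (ρ ^ D * X D)) + 2 * (D : ℝ) * (G * (ρ ^ (D - 1) * X (D - 1))))) := by
    rw [designValue_ccPow_eq_shellAvg t ht C w M (fun U₁ => ψ ((U₁ ∩ H).card : ℤ)) 2, ← mul_assoc,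
      mul_inv_cancel₀ hPM.ne', one_mul]
    exact abs_levelSum_levelSqMul_le hdes.exact hdes.variation_le hdes.level_le (fun c hc => (hdes.2.2.2.1 c hc).1) hDT _
      (fun k => G * (ρ ^ k * X k)) (fun k => mul_nonneg hG0 (mul_nonneg (pow_nonneg hρ0 k) (hX0 k)))
      (fun k hk j hj => hKplain ψ G hG0 hG k hk j hj)
  -- T3 and T5: `Y·ψ₁`, `Y·ψ` (brick 119)
  have hdes1 : IsExactDesign n ((t₁ + 1) + 2 * (D + 1) + 1) T D Bv C w := by
    rw [show t₁ + 1 + 2 * (D + 1) + 1 = t by rw [htdef]; ring]; exact hdes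
  have hX1 : ∀ k, D ≤ k → k ≤ D + 1 → ∀ c' : ℕ, Even c' → c' + 2 * k + 1 ≤ T →
      ∀ S' : Finset (Fin n), (∀ u ∈ S', π u ∈ S') → S'.card + 4 * k + 2 = n →
      ∑ x ∈ Icc (0 : ℤ) ((t₁ + 1 + 2 * (D + 1) : ℕ) : ℤ),
        |nab2^[k] (fun c x => shellLaw π S' H (t₁ + 1 + 2 * (D + 1) - 2 * k) c x : Profile) c' x| ≤ X k := by
    intro k _ hk c' _ hc' S' hS' hcard
    have := hX k hk 1 (by omega) c' (by omega) S' hS' (by omega)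
    rw [e10] at this
    exact this
  have hT35 : ∀ (χ : ℤ → ℝ) (G' : ℝ), 0 ≤ G' → (∀ x ∈ Icc (0 : ℤ) ((t : ℕ) : ℤ), |χ x| ≤ G') →
      |PM * ∑ U : OddSet n, levelWeight n t C w U M * (((half π U.1 ∩ H).card : ℝ) * χ ((U.1 ∩ H).card : ℤ))| ≤
      (2 * (D : ℝ) + 1) * ((((2 * D).choose D : ℕ) : ℝ) / (4 : ℝ) ^ D) * (((H.card : ℝ) / n) * (G' * (ρ ^ D * X D))) +
        Bv * ((((T - 1) / 2).choose (D + 1) : ℕ) : ℝ) *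
          ((T : ℝ) * (((H.card : ℝ) / n) * (G' * (ρ ^ (D + 1) * X (D + 1)))) +
            2 * ((D : ℝ) + 1) * (((H.card : ℝ) / n) * (G' * (ρ ^ D * X D)))) := by
    intro χ G' hG'0 hG'
    have htt : t₁ + 1 + 2 * (D + 1) + 1 = t := by rw [htdef]; ring
    have h := abs_designValue_halfCount_blockStat_le hdes1 hDT M H χ hG'0 (by rw [htt]; exact hG') hm (by omega) X hX0 hX1
    rw [htt] at h
    exact h
  -- T4: `cc·Y·ψ` (§1 with the half-pinned smoothness)
  have hT4 : |PM * ∑ U : OddSet n, levelWeight n t C w U M *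
      ((cc U M : ℝ) ^ 1 * (((half π U.1 ∩ H).card : ℝ) * ψ ((U.1 ∩ H).card : ℤ)))| ≤
      (2 * (D : ℝ) + 1) * ((((2 * D).choose D : ℕ) : ℝ) / (4 : ℝ) ^ D) *
          ((T : ℝ) * (((H.card : ℝ) / n) * (G * (ρ ^ D * X D))) +
            2 * (D : ℝ) * (((H.card : ℝ) / n) * (G * (ρ ^ (D - 1) * X (D - 1))))) +
        Bv * ((((T - 1) / 2).choose (D + 1) : ℕ) : ℝ) *
          ((T : ℝ) * ((T : ℝ) * (((H.card : ℝ) / n) * (G * (ρ ^ (D + 1) * X (D + 1)))) +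
              2 * ((D : ℝ) + 1) * (((H.card : ℝ) / n) * (G * (ρ ^ D * X D)))) +
            2 * ((D : ℝ) + 1) * ((T : ℝ) * (((H.card : ℝ) / n) * (G * (ρ ^ D * X D))) +
              2 * (D : ℝ) * (((H.card : ℝ) / n) * (G * (ρ ^ (D - 1) * X (D - 1)))))) := by
    rw [designValue_ccPow_eq_shellAvg t ht C w M (fun U₁ => ((half π U₁ ∩ H).card : ℝ) * ψ ((U₁ ∩ H).card : ℤ)) 1,
      ← mul_assoc, mul_inv_cancel₀ hPM.ne', one_mul]
    simp only [pow_one]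
    -- on the design levels, `E_c[Y ψ] = c · θ(c)` with `θ(c) = (1/n) Σ_v φ'_v(c−1)`
    set θ : ℕ → ℝ := fun c => (1 / (n : ℝ)) * ∑ v ∈ H, φ' v (c - 1) with hθ
    have hlev : ∀ c ∈ C, w c * ((c : ℝ) * ((∑ U' ∈ shell π t c, ((half π U' ∩ H).card : ℝ) * ψ ((U' ∩ H).card : ℤ)) /
        ((shell π t c).card : ℝ))) = w c * ((c : ℝ) ^ 2 * θ c) := by
      intro c hc
      obtain ⟨hcodd, h3c, hcT, -⟩ := hdes.2.2.2.1 c hc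
      obtain ⟨c₀, rfl⟩ : ∃ c₀, c = c₀ + 1 := ⟨c - 1, by omega⟩
      obtain ⟨t₀, ht₀⟩ : ∃ t₀, t = t₀ + 1 := ⟨t - 1, by omega⟩
      have hc₀ : Odd (c₀ + 1) := hcodd
      rw [ht₀] at ht
      have h := Summit.PneNP.PneNP.Theorems.ChebyshevTracialDesignHalfPinnedNull.shellAvg_halfCount_blockStat_eq M H ψ ht hc₀
        (by omega) (by omega)
      rw [ht₀, h, hθ, hφ']
      simp only [Nat.add_sub_cancel, show t - 1 = t₀ by omega]
      push_cast
      ring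
    rw [sum_congr rfl hlev]
    have hθodd : (fun j => θ (2 * j + 1)) = fun j => (1 / (n : ℝ)) * ∑ v ∈ H, φ' v (2 * j) := by
      funext j; rw [hθ]; simp only [Nat.add_sub_cancel]
    refine abs_levelSum_levelSqMul_le hdes.exact hdes.variation_le hdes.level_le (fun c hc => (hdes.2.2.2.1 c hc).1) hDT θ
      (fun k => ((H.card : ℝ) / n) * (G * (ρ ^ k * X k)))
      (fun k => mul_nonneg (div_nonneg (Nat.cast_nonneg _) (Nat.cast_nonneg _))
        (mul_nonneg hG0 (mul_nonneg (pow_nonneg hρ0 k) (hX0 k)))) ?_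
    intro k hk j hj
    rw [hθodd]
    exact hKhalf k hk j hj
  -- T6: `Y(Y−1)·ψ` (brick 119b)
  have hX2 : ∀ k, D ≤ k + 1 → k ≤ D + 1 → ∀ c'' : ℕ, Odd c'' → c'' + 2 * k + 2 ≤ T →
      ∀ S' : Finset (Fin n), (∀ u ∈ S', π u ∈ S') → S'.card + 4 * k + 4 = n →
      ∑ x ∈ Icc (0 : ℤ) ((t₁ + 2 * (D + 1) : ℕ) : ℤ),
        |nab2^[k] (fun c x => shellLaw π S' H (t₁ + 2 * (D + 1) - 2 * k) c x : Profile) c'' x| ≤ X k := by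
    intro k _ hk c'' _ hc'' S' hS' hcard
    have := hX k hk 2 (by omega) c'' (by omega) S' hS' (by omega)
    rw [e20] at this
    exact this
  have hT6 := abs_designValue_halfPairs_blockStat_le hdes hDT M H ψ hG0 hG hm hmn X hX0 hX2
  -- Step 3: combine
  exact abs_seven_le hlam hkap PM _ _ _ _ _ _ _ _ _ _ _ _ _ _ _ hT0 hT1 hT2 (hT35 ψ₁ _ hG₁0 hG₁) hT4 (hT35 ψ G hG0 hG) hT6

end Summit.PneNP.PneNP.Theorems.ChebyshevTracialDesignCrossingPlaneReduction

end
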